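import Summits.CriticalPhenomena.SAWScalingLimit.Theorems.LeftRightFKG.Negative.RectMesh
import Summits.CriticalPhenomena.SAWScalingLimit.Theorems.LeftRightFKG.Negative.BoxCensus
import Summits.CriticalPhenomena.SAWScalingLimit.Theorems.LeftRightFKG.Negative.PolyCert
import Literature.Probability.RandomPlanarGeometry.SelfAvoidingWalkProofs
import HarnessLib

/-!
# Negative knowledge on crux `LeftRightFKG`, part 12: the `4 × 4` corner inequality at the `SAW.weight` level
(certified-compute lane)

A POSITIVE finite instance of the crux `stmt-CriticalPhenomena-11232`
(`Summit.CriticalPhenomena.SAWScalingLimit.Theses.SAWLeftRightFKG.LeftRightFKG`), certified end to end against the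
crux's own objects: mesh `δ = 1`; `C₄` = the 20-step counter-clockwise boundary walk of the lattice square
`[-1, 4]²` based at `c₀ = (-1,-1)`; `Ω(C₄) = {z | wind(C₄ − z) ≠ 0}` exactly as the crux builds it (its discrete
domain is `ℤ²` induced on the `4 × 4` box `{0,…,3}²`, `dAdj₄_iff`, by parts 7/7b); marked corners `a = (0,0)`,
`b = (3,3)` with boundary neighbours `a' = (0,-1)`, `b' = (3,4)` on `C₄` (`isInstance₄`); the corner up-events
`A₄` = "first step North" and `B₄` = "last step from the West neighbour `(2,3)`" (read on the code of the chord);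
and the crux's measure `SAW.weight` (fugacity `x_c`):

**`weight_corner_ineq₄`**: `w(A₄) · w(B₄) ≤ w(univ) · w(A₄ ∩ B₄)` — the crux's inequality for this
`(C, a, b, A, B)` (equivalently the corner minor `M_ES M_NW − M_EW M_NS > 0` of part 9, `sq4`).

Pipeline (all kernel-checked, axioms `propext/Classical.choice/Quot.sound` only): the four weights are partition
polynomials in `x_c` by the certified event census of part 11 run on `ℤ × ℤ` (`decide +kernel`, 184 chords:
`w(univ) = 20x⁶+36x⁸+48x¹⁰+48x¹²+32x¹⁴`, `w(A₄) = w(B₄) = 10x⁶+18x⁸+24x¹⁰+24x¹²+16x¹⁴`,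
`w(A₄ ∩ B₄) = 6x⁶+6x⁸+10x¹⁰+12x¹²+8x¹⁴`), and the real inequality
`Z_A Z_B < Z_univ Z_{A∩B}` holds on the whole elementary window `[1/3, 1/2] ∋ x_c` by one `decide +kernel` on the
tree's validated-numerics checker (`PolyCert.minor_pos_of_posOn`).  Everything is elementary ("folklore").
-/

noncomputable section

namespace Summit.CriticalPhenomena.SAWScalingLimit.Theorems.LeftRightFKG.Negative.CornerCert

open MeasureTheory Set Literature.Probability.LatticeModels Literature.Probability.RandomPlanarGeometry
  Literature.Topology.PlaneTopology Literature.Analysis.ValidatedNumerics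
open Summit.CriticalPhenomena.SAWScalingLimit.Theorems.BoundaryTP2.Negative (pathsFrom endsAt)
open Census
open PolyMP (evalR)
open PolyCert (realOf)
open scoped ENNReal

/-! ## The instance: the boundary walk of `[-1,4]²`, its domain, the corners -/

/-- **The boundary walk `C₄`** of the square `[-1, 4]²`, counter-clockwise from `c₀ = (-1,-1)` (20 unit steps).
[folklore] -/
def C₄ : (zdGraph 2).Walk c₀ c₀ :=
  .cons (adj_bx (-1) (-1) 0 (-1) (by decide)) <| .cons (adj_bx 0 (-1) 1 (-1) (by decide)) <|
  .cons (adj_bx 1 (-1) 2 (-1) (by decide)) <| .cons (adj_bx 2 (-1) 3 (-1) (by decide)) <|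
  .cons (adj_bx 3 (-1) 4 (-1) (by decide)) <| .cons (adj_bx 4 (-1) 4 0 (by decide)) <|
  .cons (adj_bx 4 0 4 1 (by decide)) <| .cons (adj_bx 4 1 4 2 (by decide)) <|
  .cons (adj_bx 4 2 4 3 (by decide)) <| .cons (adj_bx 4 3 4 4 (by decide)) <|
  .cons (adj_bx 4 4 3 4 (by decide)) <| .cons (adj_bx 3 4 2 4 (by decide)) <|
  .cons (adj_bx 2 4 1 4 (by decide)) <| .cons (adj_bx 1 4 0 4 (by decide)) <|
  .cons (adj_bx 0 4 (-1) 4 (by decide)) <| .cons (adj_bx (-1) 4 (-1) 3 (by decide)) <|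
  .cons (adj_bx (-1) 3 (-1) 2 (by decide)) <| .cons (adj_bx (-1) 2 (-1) 1 (by decide)) <|
  .cons (adj_bx (-1) 1 (-1) 0 (by decide)) <| .cons (adj_bx (-1) 0 (-1) (-1) (by decide)) <| .nil

/-- The crux's domain of `C₄` at mesh `1`: `Ω₄ = {z | wind(C₄ − z) ≠ 0}` (= `Rect.Ω C₄`, by `rfl`). [folklore] -/
abbrev Ω₄ : Set ℂ := Rect.Ω C₄

/-- `Ω₄` is literally the crux's `let Ω` for `C₄` and `δ = 1`. [folklore] -/
theorem Ω₄_eq : Ω₄ = {z | wind (fun t : ℝ => Set.IccExtend zero_le_one (C₄.toCurve (meshPoint 1)) t - z) ≠ 0} := rfl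

/-- Boolean membership in the open box `(-1,4)² ∩ ℤ² = {0,…,3}²`, on integer pairs. [folklore] -/
def inV₄ (p : ℤ × ℤ) : Bool := decide (0 ≤ p.1) && decide (p.1 ≤ 3) && decide (0 ≤ p.2) && decide (p.2 ≤ 3)

/-- `inV₄` is the box of part 7. [folklore] -/
theorem inV₄_iff (x : Site 2) : inV₄ (toZ2 x) = true ↔ x ∈ Rect.box (-1) 4 (-1) 4 := by
  simp only [inV₄, toZ2_mk, Bool.and_eq_true, decide_eq_true_eq, Rect.box, mem_setOf_eq]
  omega

/-- **The discrete domain of `Ω₄` is `ℤ²` induced on the `4 × 4` box** (parts 7/7b, the five decidable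
boundary-walk hypotheses discharged by `decide`). [folklore] -/
theorem dAdj₄_iff (x y : Site 2) : (discreteDomainGraph Ω₄ 1).Adj x y ↔
    (zdGraph 2).Adj x y ∧ inV₄ (toZ2 x) = true ∧ inV₄ (toZ2 y) = true := by
  rw [inV₄_iff, inV₄_iff]
  refine Rect.dAdj_iff (x₀ := -1) (x₁ := 4) (y₀ := -1) (y₁ := 4) (m₀ := 0) (k₀ := 0) (by decide) (by decide)
    (fun i j hi hi' hj hj' hb => ?_) (by decide) (by decide)
  interval_cases i <;> interval_cases j <;> first | decide | (exfalso; omega)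

/-- `(C₄, a, b, a', b')` with `a = (0,0)`, `b = (3,3)`, `a' = (0,-1)`, `b' = (3,4)` IS a crux instance: mesh
`1 > 0`, `a', b'` on the boundary walk, `a ∼ a'`, `b ∼ b'`. [folklore] -/
theorem isInstance₄ : (0 : ℝ) < 1 ∧ bx 0 (-1) ∈ C₄.support ∧ bx 3 4 ∈ C₄.support ∧
    (zdGraph 2).Adj (bx 0 0) (bx 0 (-1)) ∧ (zdGraph 2).Adj (bx 3 3) (bx 3 4) :=
  ⟨one_pos, by decide, by decide, adj_bx _ _ _ _ (by decide), adj_bx _ _ _ _ (by decide)⟩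

/-! ## The events and their censuses -/

/-- Code test "the second site is `q`" (first step to `q`). [folklore] -/
def firstIs (q : ℤ × ℤ) : List (ℤ × ℤ) → Bool
  | _ :: r :: _ => eqZ2 r q
  | _ => false

/-- Code test "the penultimate site is `q`" (last step from `q`). [folklore] -/
def lastFrom (q : ℤ × ℤ) (s : List (ℤ × ℤ)) : Bool := firstIs q s.reverse

/-- The corner up-event at `a`: **first step North**, to `(0,1)` (read on the code of the chord). [folklore] -/
def A₄ : Set (SAW.DomainSAW Ω₄ 1 (bx 0 0) (bx 3 3)) := {γ | firstIs (0, 1) (γ.walk.support.map toZ2) = true}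

/-- The corner up-event at `b`: **last step from the West neighbour** `(2,3)`. [folklore] -/
def B₄ : Set (SAW.DomainSAW Ω₄ 1 (bx 0 0) (bx 3 3)) := {γ | lastFrom (2, 3) (γ.walk.support.map toZ2) = true}

/-- The certified enumeration of the codes of the chords `(0,0) → (3,3)` (184 of them). [folklore] -/
abbrev L₄ : List (List (ℤ × ℤ)) := (pathsFrom eqZ2 (nbV inV₄) 15 (0, 0) []).filter (endsAt eqZ2 (3, 3))

/-- Every chord of `Ω₄` from `(0,0)` has at most `15` steps (16 sites). [folklore] -/
theorem length_le₄ (γ : SAW.DomainSAW Ω₄ 1 (bx 0 0) (bx 3 3)) : γ.length ≤ 15 := by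
  refine length_le_of_card dAdj₄_iff (T := (Finset.Icc (0 : ℤ) 3) ×ˢ (Finset.Icc (0 : ℤ) 3)) (fun p hp => ?_)
    (by decide) (by decide) γ
  simp only [inV₄, Bool.and_eq_true, decide_eq_true_eq] at hp
  simp only [Finset.mem_product, Finset.mem_Icc]
  omega

/-- The enumeration is duplicate-free (kernel). [folklore] -/
theorem nodup_L₄ : L₄.Nodup := by
  decide +kernel

/-- Census of all chords: `20x⁶ + 36x⁸ + 48x¹⁰ + 48x¹² + 32x¹⁴` (kernel). [folklore] -/
theorem census_univ₄ : censusList (L₄.filter fun _ => true) 15 = [0, 0, 0, 0, 0, 0, 20, 0, 36, 0, 48, 0, 48, 0, 32, 0] := by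
  decide +kernel

/-- Census of `A₄`: `10x⁶ + 18x⁸ + 24x¹⁰ + 24x¹² + 16x¹⁴` (kernel). [folklore] -/
theorem census_A₄ : censusList (L₄.filter (firstIs (0, 1))) 15 = [0, 0, 0, 0, 0, 0, 10, 0, 18, 0, 24, 0, 24, 0, 16, 0] := by
  decide +kernel

/-- Census of `B₄`: `10x⁶ + 18x⁸ + 24x¹⁰ + 24x¹² + 16x¹⁴` (kernel). [folklore] -/
theorem census_B₄ : censusList (L₄.filter (lastFrom (2, 3))) 15 = [0, 0, 0, 0, 0, 0, 10, 0, 18, 0, 24, 0, 24, 0, 16, 0] := by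
  decide +kernel

/-- Census of `A₄ ∩ B₄`: `6x⁶ + 6x⁸ + 10x¹⁰ + 12x¹² + 8x¹⁴` (kernel). [folklore] -/
theorem census_AB₄ : censusList (L₄.filter fun s => firstIs (0, 1) s && lastFrom (2, 3) s) 15 =
    [0, 0, 0, 0, 0, 0, 6, 0, 6, 0, 10, 0, 12, 0, 8, 0] := by
  decide +kernel

/-- **Weights as partition polynomials**: for an event read on codes by `p`, the crux's weight is
`ofReal (Z_p(x_c))` with `Z_p` the census polynomial of `L₄.filter p`. [folklore] -/
theorem weight_eq_evalR₄ (p : List (ℤ × ℤ) → Bool) (E : Set (SAW.DomainSAW Ω₄ 1 (bx 0 0) (bx 3 3)))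
    (hE : ∀ γ, γ ∈ E ↔ p (γ.walk.support.map toZ2) = true) :
    SAW.weight Ω₄ 1 (bx 0 0) (bx 3 3) E =
      ENNReal.ofReal (evalR (realOf (censusList (L₄.filter p) 15)) SAW.criticalFugacity) := by
  have hx : 0 ≤ SAW.criticalFugacity := SAW.criticalFugacity_pos_lt_one'.1.le
  have h0 : toZ2 (bx 0 0) = ((0 : ℤ), (0 : ℤ)) := rfl
  have h3 : toZ2 (bx 3 3) = ((3 : ℤ), (3 : ℤ)) := rfl
  have hw := weightAt_eq_ofReal_sum dAdj₄_iff length_le₄ (by rw [h0, h3]; exact nodup_L₄) p E hE hx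
  have hb := length_bounds_of_enum dAdj₄_iff length_le₄ p
  rw [h0, h3] at hw hb
  rw [← weightAt_criticalFugacity, hw, sum_pow_eq_census _ 15 hb, ← PolyCert.evalR_realOf_eq_sum]

/-! ## The certificate and the inequality -/

/-- Kernel certificate: `Z_A Z_B < Z_univ Z_{A∩B}` on the elementary window `[1/3, 1/2]` (the tree's sign checker on
the interval minor; the minor is `sq4`'s `x¹²(20 − 24x² − 100x⁴ − …)`). [folklore] -/
theorem weight4_posOn :
    PolyMP.posOn (2 ^ 128) 6 (PolyCert.minorI (2 ^ 128)
      [0, 0, 0, 0, 0, 0, 20, 0, 36, 0, 48, 0, 48, 0, 32, 0] [0, 0, 0, 0, 0, 0, 6, 0, 6, 0, 10, 0, 12, 0, 8, 0]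
      [0, 0, 0, 0, 0, 0, 10, 0, 18, 0, 24, 0, 24, 0, 16, 0] [0, 0, 0, 0, 0, 0, 10, 0, 18, 0, 24, 0, 24, 0, 16, 0])
      (1 / 3) (1 / 2) = true := by
  decide +kernel

/-- **The crux's inequality for the `4 × 4` corner instance, at the `SAW.weight` level**:
`w(A₄) · w(B₄) ≤ w(univ) · w(A₄ ∩ B₄)` for the critical SAW measure of `Ω(C₄)_1` between the corners
`(0,0) → (3,3)` and the corner up-events "first step North", "last step from the West".  Unconditional and
axiom-clean (`x_c ∈ [1/3, 1/2]` is elementary). [folklore] -/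
theorem weight_corner_ineq₄ :
    SAW.weight Ω₄ 1 (bx 0 0) (bx 3 3) A₄ * SAW.weight Ω₄ 1 (bx 0 0) (bx 3 3) B₄ ≤
      SAW.weight Ω₄ 1 (bx 0 0) (bx 3 3) Set.univ * SAW.weight Ω₄ 1 (bx 0 0) (bx 3 3) (A₄ ∩ B₄) := by
  have hA := weight_eq_evalR₄ (firstIs (0, 1)) A₄ fun γ => Iff.rfl
  have hB := weight_eq_evalR₄ (lastFrom (2, 3)) B₄ fun γ => Iff.rfl
  have hU := weight_eq_evalR₄ (fun _ => true) Set.univ fun γ => by simp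
  have hAB := weight_eq_evalR₄ (fun s => firstIs (0, 1) s && lastFrom (2, 3) s) (A₄ ∩ B₄) fun γ => by
    simp only [A₄, B₄, Set.mem_inter_iff, Set.mem_setOf_eq, Bool.and_eq_true]
  rw [hA, hB, hU, hAB, census_univ₄, census_A₄, census_B₄, census_AB₄]
  have h1 := SAW.one_third_le_criticalFugacity
  have h2 := SAW.criticalFugacity_le_half
  have hlt := PolyCert.minor_pos_of_posOn (by norm_num) weight4_posOn (by norm_num)
    (x := SAW.criticalFugacity) (by push_cast; linarith) (by push_cast; linarith)
  have hx : 0 ≤ SAW.criticalFugacity := SAW.criticalFugacity_pos_lt_one'.1.le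
  have hnn : ∀ cs : List ℤ, (∀ c ∈ cs, 0 ≤ c) → 0 ≤ evalR (realOf cs) SAW.criticalFugacity :=
    fun cs hcs => PolyCert.evalR_realOf_nonneg hcs hx
  rw [← ENNReal.ofReal_mul (hnn _ (by decide)), ← ENNReal.ofReal_mul (hnn _ (by decide))]
  exact ENNReal.ofReal_le_ofReal hlt.le

end Summit.CriticalPhenomena.SAWScalingLimit.Theorems.LeftRightFKG.Negative.CornerCert
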